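import Summits.BirchSwinnertonDyer.BirchSwinnertonDyer.Theorems.PrintCFramBottomClassIndexLawFiveLeHerbrandLineCharacters
import Summits.BirchSwinnertonDyer.BirchSwinnertonDyer.Theorems.PrintCFramBottomClassIndexLawFiveLeEisensteinTraceForm
import Literature.NumberTheory.EllipticCurves.OpenImageMazurCharacterProofs
import Summits.BirchSwinnertonDyer.BirchSwinnertonDyer.Theorems.PrintCFramBottomClassIndexLawFiveLeEisensteinPairUnique
import Literature.NumberTheory.EllipticCurves.Kato2004.SemilocalDecompositionProofs
import Literature.NumberTheory.EllipticCurves.LFunctionPrimeCoeff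
import HarnessLib

/-!
# Crux `PrintCFram.BottomClassIndexLawFiveLe` (stmt-BirchSwinnertonDyer-20372), line `eisenstein-resource-bdp-line` (v10):
# Stub H, typing item T1, part 3 — THE LINE CHARACTER IS A DIRICHLET CHARACTER: `θ_S = b ∘ χ_m ∘ res` with
# `a_q(W) ≡ b(q) + q·b(q)⁻¹ (mod p)` at every good prime `q ∤ pm`

Cell `bsd-print-cfram`, LEAD seat `bsd-line-cfram-p1` (generation g8), `--supports stmt-BirchSwinnertonDyer-20372` (helper).
THEOREMS ONLY; no definition, no named fact, no `sorry`. BSD is not proved by any of this; no summit statement is proved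
by this seat.

WHAT. Parts 1–2 (`…HerbrandLineCharacters`, `…HerbrandLineCharactersQuadratic`; p647967, p648640) gave the Galois-side shape of
the two characters `θ_S, θ_Q : Γ_{K''} → 𝔽_pˣ` of a stable line `Φ ≤ W_{K''}[p]` and its quotient (`θ_Q = ε θ_S`, `θ_S θ_Q = χ̄_p`,
`θ_S = β χ̄_p^{(p+1)/4}` with `β` quadratic). Stub H's Bernoulli bookkeeping needs them matched with Kriz–Li's DIRICHLET character `ψ`
of the hypothesis `hss` (`a_ℓ ≡ ψ(ℓ) + ψ⁻¹(ℓ)ω(ℓ)`). This file provides the bridge in the tree's own currency, with NO Chebotarev: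
the character `r : Γ_ℚ → 𝔽_pˣ` of the rational line `W[𝔭]` has open kernel, so by the tree's PROVED Kronecker–Weber theorem in
character form (`Mazur1978.exists_comp_modNCyclotomicCharacter_eq`) it factors through a cyclotomic character,
**`r = b ∘ χ_m`** for some level `m` and `b : (ℤ/m)ˣ → 𝔽_pˣ`; at an arithmetic Frobenius `φ_q` (`q ∤ pm` good) `χ_m(φ_q) = q`
and Mazur's Prop. 6.3 (1) (`isogenyCharacter_add_div_eq_frobeniusTrace`) reads **`a_q(W) ≡ b(q) + q·b(q)⁻¹ (mod p)`** — i.e. the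
pair `(b, id)` satisfies Kriz–Li's trace congruence in `𝔽_p`. Over any quadratic `K` the character `θ_S` of ANY stable line of
order `p` is `r ∘ res` (uniqueness of the line), and `θ_Q = χ̄_p · (r ∘ res)⁻¹`. Consequently (w3 g3's uniqueness of the Eisenstein
pair, `EisensteinPair.eq_or_eq_of_traceForm_congr`, applied to the Teichmüller lift of `b`) the Dirichlet character of the line is
Kriz–Li's `ψ` or `ψ⁻¹ω` — the last clause is recorded here in `𝔽_p`-currency (§3) and left in `ℚ_p`-currency to the consumer.

* §1 `exists_cyclotomicFactor_traceForm_of_isRationalLine` — over `ℚ`: generator `P`, isogeny character `r`, level `m`,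
  `b : (ℤ/m)ˣ →* (ℤ/p)ˣ` with `r = b ∘ χ_m` and the trace congruence at every good prime `q ≠ p` coprime to `m`.
* §2 `charSub_eq_comp_absGaloisRestrict` / `charQuot_eq_cyclotomic_mul_inv` — over a quadratic `K`: `θ_S = r ∘ res`,
  `θ_Q = χ̄_p·(r ∘ res)⁻¹` for every stable line of order `p` (Stub H's quantifiers).
* §3 `exists_dirichletFactor_charSub_of_cmRamified` — packaged END STATE for Stub H: `θ_S = b ∘ χ_m ∘ res`,
  `θ_Q = χ̄_p·(b ∘ χ_m ∘ res)⁻¹`, and `a_q ≡ b(q) + q b(q)⁻¹ (mod p)` for all primes `q ∤ p·m·N_W`.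
* §4 `ℚ_p`-currency: `exists_teichmuller_dirichletCharacter` (the Teichmüller lift `ψ₁` of `b`, as an `∃`),
  `norm_traceForm_sub_lt_one_of_congr` (`ψ₁` satisfies Kriz–Li's `hss` at `q`), and the END STATE
  `exists_dirichletCharacter_charSub_eq_or_eq_of_hss`: given Kriz–Li's `(ψ, ω, hss)` for `W`, the character of every stable line is
  `b ∘ χ_m ∘ res` with `ψ₁ = Teich ∘ b` and **`ψ↑ = ψ₁↑` or `ψ↑ = ψ₁⁻¹↑·ω↑`** at level `f·m·p` (w3 g3's uniqueness of the Eisenstein pair).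

References: Mazur, *Rational isogenies of prime degree*, Invent. Math. 44 (1978) §5 (isogeny character), Prop. 6.3 (1); Washington,
*Introduction to Cyclotomic Fields*, Thm. 14.1 (Kronecker–Weber); Kriz–Li 2019 §1.5/§7.1 (the pair `(ψ, ψ⁻¹ω)`); the herbrand M1 memo.
-/

noncomputable section

-- summit-side namespace `Summit.BirchSwinnertonDyer.BirchSwinnertonDyer.Theorems.…` (single-conjunct summit, D-0017 layout)
set_option linter.dupNamespace false
set_option autoImplicit false

open scoped Classical
open NumberField WeierstrassCurve Field IsDedekindDomain IsDedekindDomain.HeightOneSpectrum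
open Literature.NumberTheory.EllipticCurves Literature.NumberTheory.GaloisRepresentations
  Literature.NumberTheory.EllipticCurves.Rank1Residual
open Summit.BirchSwinnertonDyer.Rank1Residual
open Summit.BirchSwinnertonDyer.BirchSwinnertonDyer.Theorems.PrintCFram.BorelHomothety

namespace Summit.BirchSwinnertonDyer.BirchSwinnertonDyer.Theorems.PrintCFram.HerbrandLineCharacters

/-! ## §1 Over `ℚ`: the isogeny character of a rational line is `b ∘ χ_m`, and `a_q ≡ b(q) + q b(q)⁻¹` -/

section OverQ

variable (W : WeierstrassCurve ℚ) [W.IsElliptic] [W.IsGloballyMinimal] (p : ℕ) [hp : Fact p.Prime]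

/-- **The line character is a Dirichlet character, and the trace congruence.** For a globally minimal elliptic `W/ℚ`, a prime `p`
and a rational line `Φ ≤ W[p]` (`Γ_ℚ`-stable of order `p`): `Φ = ⟨P⟩` with isogeny character `r` (`σP = r(σ)P`), and there are a
level `m ≥ 1` and a homomorphism `b : (ℤ/m)ˣ → 𝔽_pˣ` with `r = b ∘ χ_m` (`χ_m` the mod-`m` cyclotomic character; Kronecker–Weber
for the open-kernel character `r`, tree `Mazur1978.exists_comp_modNCyclotomicCharacter_eq`) such that at every prime `q ≠ p` of good
reduction coprime to `m`: `a_q(W) ≡ b(q) + q·b(q)⁻¹ (mod p)` (Mazur Prop. 6.3 (1) at an arithmetic Frobenius `φ_q`, where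
`χ_m(φ_q) = q`). [cite: Mazur1978, §5 (p. 148) and §6 Prop. 6.3 (1) (p. 153)] [cite: Washington1997, Thm. 14.1 (Kronecker–Weber)] -/
theorem exists_cyclotomicFactor_traceForm_of_isRationalLine {Φ : AddSubgroup (W.geomTorsion (p : ℤ))}
    (hΦ : IsRationalLine W p Φ) :
    ∃ (P : W.geomTorsion (p : ℤ)) (r : absoluteGaloisGroup ℚ →* (ZMod p)ˣ) (m : ℕ) (_ : NeZero m)
      (b : (ZMod m)ˣ →* (ZMod p)ˣ),
      P ≠ 0 ∧ Φ = AddSubgroup.zmultiples P ∧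
      (∀ σ : absoluteGaloisGroup ℚ, σ • P = ((r σ : (ZMod p)ˣ) : ZMod p).val • P) ∧
      (∀ σ : absoluteGaloisGroup ℚ, r σ = b (modNCyclotomicCharacter ℚ m σ)) ∧
      ∀ (q : ℕ) [Fact q.Prime], q ≠ p → W.HasGoodReductionAtPrime q → ∀ hqm : q.Coprime m,
        (W.frobeniusTrace q : ZMod p) =
          ((b (ZMod.unitOfCoprime q hqm) : (ZMod p)ˣ) : ZMod p) +
            (q : ZMod p) * (((b (ZMod.unitOfCoprime q hqm))⁻¹ : (ZMod p)ˣ) : ZMod p) := by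
  haveI : NeZero ((p : ℕ) : ℚ) := ⟨by exact_mod_cast hp.out.ne_zero⟩
  obtain ⟨P, hP0, rfl⟩ := Mazur1978.exists_eq_zmultiples_of_natCard_eq W p hΦ.1
  have hst : ∀ σ : absoluteGaloisGroup ℚ, σ • P ∈ AddSubgroup.zmultiples P :=
    fun σ => hΦ.2 σ P (AddSubgroup.mem_zmultiples P)
  obtain ⟨r, hr⟩ := Mazur1978.exists_isogenyCharacter W p hP0 hst
  -- Kronecker–Weber for the open-kernel character `r`
  have hker := Mazur1978.isOpen_ker_of_smul_eq W p hP0 hr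
  obtain ⟨m, hm, b, hb⟩ := Mazur1978.exists_comp_modNCyclotomicCharacter_eq r hker
  refine ⟨P, r, m, hm, b, hP0, rfl, hr, fun σ => (hb σ).symm, fun q hq hqp hgood hqm => ?_⟩
  -- an arithmetic Frobenius at `q`
  set v : HeightOneSpectrum (𝓞 ℚ) := (Rat.HeightOneSpectrum.primesEquiv (R := 𝓞 ℚ)).symm ⟨q, hq.out⟩ with hvdef
  have hvq : (Rat.HeightOneSpectrum.primesEquiv v : ℕ) = q := by
    rw [hvdef, Equiv.apply_symm_apply]
  have hv : (q : 𝓞 ℚ) ∈ v.asIdeal := by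
    rw [DeuringLadic.natCast_mem_asIdeal_iff, hvq]
  obtain ⟨𝔓, h𝔓⟩ := v.primesAbove_nonempty
  obtain ⟨φ, hφ⟩ := exists_isArithFrobAt_of_mem_primesAbove_holds (K := ℚ) (v := v) h𝔓
  have hq' : ¬ q ∣ m := fun hd => by
    have := Nat.Coprime.eq_one_of_dvd hqm hd
    exact hq.out.one_lt.ne' this
  have hχ : (modNCyclotomicCharacter ℚ m φ : ZMod m) = q :=
    Rat.modNCyclotomicCharacter_of_isArithFrobAt hq.out hq' hv h𝔓 hφ
  have hχu : modNCyclotomicCharacter ℚ m φ = ZMod.unitOfCoprime q hqm :=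
    Units.ext (by rw [hχ, ZMod.coe_unitOfCoprime])
  have hmaz := Mazur1978.isogenyCharacter_add_div_eq_frobeniusTrace W p q hqp hgood hP0 hr hv h𝔓 hφ
  rw [← hmaz, ← hb φ, hχu]

end OverQ

/-! ## §2 Over a quadratic `K`: `θ_S = r ∘ res`, `θ_Q = χ̄_p · (r ∘ res)⁻¹` for every stable line of order `p` -/

section OverK

variable (W : WeierstrassCurve ℚ) [W.IsElliptic] (p : ℕ) [hp : Fact p.Prime]
  (K : Type) [Field K] [NumberField K]

/-- **`θ_S = r ∘ res`.** For `W/ℚ` CM, `p ≥ 5` CM-ramified, a quadratic `K`, a `Γ_K`-stable `Φ ≤ W_K[p]` of order `p` with character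
`θ_S`, and ANY rational line `Φ₀ = ⟨P⟩ ≤ W[p]` over `ℚ` with isogeny character `r`: `θ_S(g) = r(res g)` for every `g ∈ Γ_K` (the stable
line over `K` is unique, w4 g3 `BorelNonScalar.eq_of_stable_of_card_eq_of_cmRamified`, hence is `Φ₀` transported along
`RatClosure.torsionEquiv`). [cite: Mazur1978, §5 (p. 148, the isogeny character)] [cite: GreenbergVatsal2000, §2 p. 28] -/
theorem charSub_eq_comp_absGaloisRestrict (hCM : W.HasCM) (h5 : 5 ≤ p) (hram : CMRamified W p)
    (hK2 : Module.finrank ℚ K = 2)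
    (Φ : X2.ResidualDevissageModules.StableSubgroup (absoluteGaloisGroup K) ((W.baseChange K).geomTorsion (p : ℤ)))
    (hcard : Nat.card Φ.Sub = p) {θS : absoluteGaloisGroup K →* (ZMod p)ˣ}
    (hθS : ∀ (g : absoluteGaloisGroup K) (x : Φ.Sub), g • x = (((θS g : ZMod p).val : ℕ) : ℤ) • x)
    {Φ₀ : AddSubgroup (W.geomTorsion (p : ℤ))} (hΦ₀ : IsRationalLine W p Φ₀)
    {P : W.geomTorsion (p : ℤ)} (hP0 : P ≠ 0) (hP : Φ₀ = AddSubgroup.zmultiples P)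
    {r : absoluteGaloisGroup ℚ →* (ZMod p)ˣ}
    (hr : ∀ σ : absoluteGaloisGroup ℚ, σ • P = ((r σ : (ZMod p)ˣ) : ZMod p).val • P)
    (g : absoluteGaloisGroup K) : θS g = r (absGaloisRestrict ℚ K g) := by
  set θ := RatClosure.torsionEquiv (K := K) W (p : ℤ) with hθ
  set Φc : AddSubgroup (W.geomTorsion (p : ℤ)) := Φ.toAddSubgroup.comap θ.toAddMonoidHom with hΦc
  obtain ⟨hstab, hc⟩ := comap_torsionEquiv_stable W p K Φ
  rw [hcard] at hc
  have heq : Φc = Φ₀ :=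
    BorelNonScalar.eq_of_stable_of_card_eq_of_cmRamified W p K hCM h5 hram hK2 hstab hc
      (fun g Q hQ => hΦ₀.2 (absGaloisRestrict ℚ K g) Q hQ) hΦ₀.1
  -- the transported generator `x = θ P ∈ Φ`
  have hPΦ : P ∈ Φc := by rw [heq, hP]; exact AddSubgroup.mem_zmultiples P
  have hθP : θ P ∈ Φ.toAddSubgroup := by
    rw [hΦc, AddSubgroup.mem_comap] at hPΦ; exact hPΦ
  set x : Φ.Sub := ⟨θ P, hθP⟩ with hx
  have hx0 : x ≠ 0 := by
    intro h0
    have h1 : θ P = 0 := congrArg Φ.incl h0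
    exact hP0 (θ.injective (by rw [h1, map_zero]))
  -- `g • x = r(res g) • x`
  have h1 : g • x = ((((r (absGaloisRestrict ℚ K g) : (ZMod p)ˣ) : ZMod p).val : ℕ) : ℤ) • x := by
    apply Φ.incl_injective
    rw [Φ.incl_smul, map_zsmul]
    change g • θ P = _ • θ P
    rw [← RatClosure.torsionEquiv_smul, hr, natCast_zsmul, map_nsmul]
  have h2 := HerbrandLineRestriction.intCast_eq_of_zsmul_eq (p := p) hcard hx0
    (a := (((θS g : ZMod p).val : ℕ) : ℤ)) (b := (((r (absGaloisRestrict ℚ K g) : (ZMod p)ˣ) : ZMod p).val : ℕ))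
    (by rw [← hθS g x, h1])
  rw [Int.cast_natCast, Int.cast_natCast, ZMod.natCast_zmod_val, ZMod.natCast_zmod_val] at h2
  exact Units.ext h2

/-- **`θ_Q = χ̄_p·(r ∘ res)⁻¹`** (from `θ_S θ_Q = χ̄_p ∘ res`, part 1). Same hypotheses, with the character `θ_Q` of `W_K[p]/Φ`.
[cite: SilvermanCSS1997, Ch. II §7 Proposition (det ρ̄_m = χ_m)] [cite: Mazur1978, §5 (p. 148)] -/
theorem charQuot_eq_cyclotomic_mul_inv (hCM : W.HasCM) (h5 : 5 ≤ p) (hram : CMRamified W p)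
    (hK2 : Module.finrank ℚ K = 2)
    (Φ : X2.ResidualDevissageModules.StableSubgroup (absoluteGaloisGroup K) ((W.baseChange K).geomTorsion (p : ℤ)))
    (hcard : Nat.card Φ.Sub = p) {θS θQ : absoluteGaloisGroup K →* (ZMod p)ˣ}
    (hθS : ∀ (g : absoluteGaloisGroup K) (x : Φ.Sub), g • x = (((θS g : ZMod p).val : ℕ) : ℤ) • x)
    (hθQ : ∀ (g : absoluteGaloisGroup K) (y : Φ.Quot), g • y = (((θQ g : ZMod p).val : ℕ) : ℤ) • y)
    {Φ₀ : AddSubgroup (W.geomTorsion (p : ℤ))} (hΦ₀ : IsRationalLine W p Φ₀)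
    {P : W.geomTorsion (p : ℤ)} (hP0 : P ≠ 0) (hP : Φ₀ = AddSubgroup.zmultiples P)
    {r : absoluteGaloisGroup ℚ →* (ZMod p)ˣ}
    (hr : ∀ σ : absoluteGaloisGroup ℚ, σ • P = ((r σ : (ZMod p)ˣ) : ZMod p).val • P)
    (g : absoluteGaloisGroup K) :
    θQ g = modPCyclotomicCharacterZMod ℚ p (absGaloisRestrict ℚ K g) * (r (absGaloisRestrict ℚ K g))⁻¹ := by
  obtain ⟨s, -, hsc⟩ := exists_sqrt_charSub_charQuot_of_cmRamified W p K hCM h5 hram hK2 Φ hcard hθS hθQ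
  obtain ⟨hprod, -⟩ := hsc g
  rw [charSub_eq_comp_absGaloisRestrict W p K hCM h5 hram hK2 Φ hcard hθS hΦ₀ hP0 hP hr g] at hprod
  rw [← hprod, mul_inv_cancel_comm]

end OverK

/-! ## §3 END STATE for Stub H: `θ_S = b ∘ χ_m ∘ res`, `θ_Q = χ̄_p·(b ∘ χ_m ∘ res)⁻¹`, `a_q ≡ b(q) + q b(q)⁻¹` -/

section EndState

variable (W : WeierstrassCurve ℚ) [W.IsElliptic] [W.IsGloballyMinimal] (p : ℕ) [hp : Fact p.Prime]
  (K : Type) [Field K] [NumberField K]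

/-- **T1, the Dirichlet factor of the line characters (END STATE, `𝔽_p`-currency).** For `W/ℚ` globally minimal with CM, `p ≥ 5`
CM-ramified, ANY quadratic `K`, ANY stable `Φ ≤ W_K[p]` of order `p` with characters `θ_S, θ_Q`: there are a level `m ≥ 1` and
`b : (ℤ/m)ˣ → 𝔽_pˣ` with `θ_S = b ∘ χ_m ∘ res`, `θ_Q = χ̄_p·(b ∘ χ_m ∘ res)⁻¹`, and `a_q(W) ≡ b(q) + q·b(q)⁻¹ (mod p)` for every prime
`q ∤ p·m·N_W`. With Kriz–Li's `hss` (`a_q ≡ ψ(q) + ψ⁻¹(q)ω(q)`) and w3 g3's uniqueness of the Eisenstein pair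
(`EisensteinPair.eq_or_eq_of_traceForm_congr`, applied to the Teichmüller lift of `b`), the Dirichlet character of the line is
`ψ` or `ψ⁻¹ω` — so the six Bernoulli numbers of the M1 table are Kriz–Li's `b₁, b₂`.
[cite: Mazur1978, §5 (p. 148) and §6 Prop. 6.3 (1) (p. 153)] [cite: Washington1997, Thm. 14.1 (Kronecker–Weber)]
[cite: KrizLi2019, §1.5 (p. 7) and §7.1 (p. 43)] -/
theorem exists_dirichletFactor_charSub_of_cmRamified (hCM : W.HasCM) (h5 : 5 ≤ p) (hram : CMRamified W p)
    (hK2 : Module.finrank ℚ K = 2)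
    (Φ : X2.ResidualDevissageModules.StableSubgroup (absoluteGaloisGroup K) ((W.baseChange K).geomTorsion (p : ℤ)))
    (hcard : Nat.card Φ.Sub = p) {θS θQ : absoluteGaloisGroup K →* (ZMod p)ˣ}
    (hθS : ∀ (g : absoluteGaloisGroup K) (x : Φ.Sub), g • x = (((θS g : ZMod p).val : ℕ) : ℤ) • x)
    (hθQ : ∀ (g : absoluteGaloisGroup K) (y : Φ.Quot), g • y = (((θQ g : ZMod p).val : ℕ) : ℤ) • y) :
    ∃ (m : ℕ) (_ : NeZero m) (b : (ZMod m)ˣ →* (ZMod p)ˣ),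
      (∀ g : absoluteGaloisGroup K, θS g = b (modNCyclotomicCharacter ℚ m (absGaloisRestrict ℚ K g))) ∧
      (∀ g : absoluteGaloisGroup K, θQ g = modPCyclotomicCharacterZMod ℚ p (absGaloisRestrict ℚ K g) *
        (b (modNCyclotomicCharacter ℚ m (absGaloisRestrict ℚ K g)))⁻¹) ∧
      ∀ (q : ℕ) [Fact q.Prime], ¬ (q ∣ p * m * W.conductorNorm ℤ) → ∀ hqm : q.Coprime m,
        (W.frobeniusTrace q : ZMod p) =
          ((b (ZMod.unitOfCoprime q hqm) : (ZMod p)ˣ) : ZMod p) +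
            (q : ZMod p) * (((b (ZMod.unitOfCoprime q hqm))⁻¹ : (ZMod p)ˣ) : ZMod p) := by
  obtain ⟨Φ₀, hstab, hc⟩ := RationalLine.exists_rationalLine_of_cmRamified W p hCM h5 hram
  have hΦ₀ : IsRationalLine W p Φ₀ := ⟨hc, hstab⟩
  obtain ⟨P, r, m, hm, b, hP0, hP, hr, hrb, htr⟩ := exists_cyclotomicFactor_traceForm_of_isRationalLine W p hΦ₀
  refine ⟨m, hm, b, fun g => ?_, fun g => ?_, fun q hq hqN hqm => ?_⟩
  · rw [← hrb]; exact charSub_eq_comp_absGaloisRestrict W p K hCM h5 hram hK2 Φ hcard hθS hΦ₀ hP0 hP hr g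
  · rw [← hrb]; exact charQuot_eq_cyclotomic_mul_inv W p K hCM h5 hram hK2 Φ hcard hθS hθQ hΦ₀ hP0 hP hr g
  · have hqp : q ≠ p := by
      rintro rfl; exact hqN (dvd_mul_of_dvd_left (dvd_mul_right q m) _)
    have hgood : W.HasGoodReductionAtPrime q := by
      by_contra hbad
      apply hqN
      exact dvd_mul_of_dvd_right ((W.dvd_conductorNorm_iff_not_hasGoodReductionAtPrime q).mpr hbad) _
    exact htr q hqp hgood hqm

end EndState

/-! ## §4 `ℚ_p`-currency: the Teichmüller lift of `b` satisfies Kriz–Li's `hss`; hence it is `ψ` or `ψ⁻¹ω` -/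

section QpAvatar

variable (p : ℕ) [hp : Fact p.Prime]

/-- The Teichmüller lift of a homomorphism `b : (ℤ/m)ˣ → 𝔽_pˣ`: a `ℚ_p`-valued Dirichlet character `ψ₁` of level `m` with
`ψ₁(u) = ω(b(u))` (`ω` the Teichmüller character `𝔽_pˣ → ℤ_pˣ`, tree `Kato2004.teichmullerChar`). Existence only — no definition
is minted. [cite: Washington1997, §5.1 (the Teichmüller character)] -/
theorem exists_teichmuller_dirichletCharacter {m : ℕ} [NeZero m] (b : (ZMod m)ˣ →* (ZMod p)ˣ) :
    ∃ ψ₁ : DirichletCharacter ℚ_[p] m, ∀ u : (ZMod m)ˣ,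
      ψ₁ (u : ZMod m) = (((Kato2004.teichmullerChar p (b u) : ℤ_[p]ˣ) : ℤ_[p]) : ℚ_[p]) := by
  refine ⟨MulChar.ofUnitHom ((Units.map (PadicInt.Coe.ringHom (p := p)).toMonoidHom).comp
    ((Kato2004.teichmullerChar p).comp b)), fun u => ?_⟩
  rw [MulChar.ofUnitHom_coe, MonoidHom.comp_apply, MonoidHom.comp_apply, Units.coe_map]
  rfl

/-- **The Teichmüller lift satisfies the trace congruence in `ℚ_p`.** If `a ≡ b(q) + q·b(q)⁻¹ (mod p)` for a prime `q ≠ p` coprime to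
`m`, then for the Teichmüller lift `ψ₁` of `b` and any Teichmüller `ω` (`KrizLi2019.IsTeichmullerCharacter`):
`‖a − (ψ₁(q) + ψ₁⁻¹(q)·ω(q))‖_p < 1` — Kriz–Li's `hss` at `q` for the pair `(ψ₁, ω)`. [cite: KrizLi2019, §1.5 (p. 7)]
[cite: Washington1997, §5.1 (the Teichmüller character)] -/
theorem norm_traceForm_sub_lt_one_of_congr {m : ℕ} [NeZero m] (b : (ZMod m)ˣ →* (ZMod p)ˣ)
    {ψ₁ : DirichletCharacter ℚ_[p] m}
    (hψ₁ : ∀ u : (ZMod m)ˣ, ψ₁ (u : ZMod m) = (((Kato2004.teichmullerChar p (b u) : ℤ_[p]ˣ) : ℤ_[p]) : ℚ_[p]))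
    {ω : DirichletCharacter ℚ_[p] p} (hω : KrizLi2019.IsTeichmullerCharacter ω)
    {q : ℕ} (hq : q.Prime) (hqp : q ≠ p) (hqm : q.Coprime m) {a : ℤ}
    (ha : (a : ZMod p) = ((b (ZMod.unitOfCoprime q hqm) : (ZMod p)ˣ) : ZMod p) +
      (q : ZMod p) * (((b (ZMod.unitOfCoprime q hqm))⁻¹ : (ZMod p)ˣ) : ZMod p)) :
    ‖(a : ℚ_[p]) - (ψ₁ (q : ZMod m) + ψ₁⁻¹ (q : ZMod m) * ω (q : ZMod p))‖ < 1 := by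
  set u : (ZMod m)ˣ := ZMod.unitOfCoprime q hqm with hu
  have hqu : (q : ZMod m) = (u : ZMod m) := (ZMod.coe_unitOfCoprime q hqm).symm
  set t : ℤ_[p]ˣ := Kato2004.teichmullerChar p (b u) with ht
  set B : ℚ_[p] := ((t : ℤ_[p]) : ℚ_[p]) with hB
  have hψq : ψ₁ (q : ZMod m) = B := by rw [hqu, hψ₁ u]
  have hψq' : ψ₁⁻¹ (q : ZMod m) = B⁻¹ := by rw [MulChar.inv_apply_eq_inv', hψq]
  have hBinv : (((t⁻¹ : ℤ_[p]ˣ) : ℤ_[p]) : ℚ_[p]) = B⁻¹ := by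
    apply eq_inv_of_mul_eq_one_right
    rw [hB, ← PadicInt.coe_mul, Units.mul_inv, PadicInt.coe_one]
  -- the integral element `z = a − (t + q t⁻¹)` reduces to `0` mod `p`
  set z : ℤ_[p] := (a : ℤ_[p]) - ((t : ℤ_[p]) + (q : ℤ_[p]) * ((t⁻¹ : ℤ_[p]ˣ) : ℤ_[p])) with hz
  have ht0 : PadicInt.toZMod (t : ℤ_[p]) = ((b u : (ZMod p)ˣ) : ZMod p) := Kato2004.toZMod_teichmullerChar p (b u)
  have ht1 : PadicInt.toZMod ((t⁻¹ : ℤ_[p]ˣ) : ℤ_[p]) = (((b u)⁻¹ : (ZMod p)ˣ) : ZMod p) := by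
    have h := Units.coe_map_inv ((PadicInt.toZMod : ℤ_[p] →+* ZMod p) : ℤ_[p] →* ZMod p) t
    have hmap : Units.map ((PadicInt.toZMod : ℤ_[p] →+* ZMod p) : ℤ_[p] →* ZMod p) t = b u :=
      Units.ext (by rw [Units.coe_map]; exact ht0)
    rw [hmap] at h
    exact h.symm
  have hz0 : PadicInt.toZMod z = 0 := by
    rw [hz, map_sub, map_add, map_mul, map_intCast, map_natCast, ht0, ht1, ha, sub_self]
  have hznorm : ‖z‖ < 1 := by
    have hmem : z ∈ RingHom.ker (PadicInt.toZMod : ℤ_[p] →+* ZMod p) := (RingHom.mem_ker).mpr hz0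
    rw [PadicInt.ker_toZMod, IsLocalRing.mem_maximalIdeal, mem_nonunits_iff, PadicInt.isUnit_iff] at hmem
    exact lt_of_le_of_ne (PadicInt.norm_le_one z) hmem
  -- `‖B⁻¹‖ = 1` and `‖q − ω(q)‖ < 1`
  have hBn : ‖B⁻¹‖ = 1 := by
    have h1 : ‖B‖ = 1 := by rw [hB, ← PadicInt.norm_def]; exact PadicInt.isUnit_iff.mp t.isUnit
    rw [norm_inv, h1, inv_one]
  have hωq : ‖(q : ℚ_[p]) - ω (q : ZMod p)‖ < 1 := by
    have h := hω (q : ℤ) (by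
      intro hd
      have : p ∣ q := by exact_mod_cast hd
      exact hqp ((Nat.prime_dvd_prime_iff_eq hp.out hq).mp this).symm)
    rw [Int.cast_natCast, Int.cast_natCast, norm_sub_rev] at h
    exact h
  -- decomposition `a − (B + B⁻¹ ω q) = z + B⁻¹ (q − ω q)` and the ultrametric inequality
  have hdec : (a : ℚ_[p]) - (ψ₁ (q : ZMod m) + ψ₁⁻¹ (q : ZMod m) * ω (q : ZMod p)) =
      (z : ℚ_[p]) + B⁻¹ * ((q : ℚ_[p]) - ω (q : ZMod p)) := by
    rw [hψq, hψq', hz]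
    push_cast
    rw [hBinv]
    ring
  rw [hdec]
  refine lt_of_le_of_lt (IsUltrametricDist.norm_add_le_max _ _) (max_lt ?_ ?_)
  · exact hznorm
  · rw [norm_mul, hBn, one_mul]; exact hωq

variable (W : WeierstrassCurve ℚ) [W.IsElliptic] [W.IsGloballyMinimal]
  (K : Type) [Field K] [NumberField K]

/-- **T1 COMPLETE (END STATE, `ℚ_p`-currency): the Dirichlet character of the line is Kriz–Li's `ψ` or `ψ⁻¹ω`.** For `W/ℚ` globally
minimal with CM, `p ≥ 5` CM-ramified, Kriz–Li character data `(ψ, ω)` for `W` at `p` (`ω` Teichmüller, `hss`: `a_ℓ ≡ ψ(ℓ) + ψ⁻¹(ℓ)ω(ℓ)`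
for `ℓ ∤ p N_W`), ANY quadratic `K` and ANY stable `Φ ≤ W_K[p]` of order `p` with characters `θ_S, θ_Q`: there are a level `m`,
`b : (ℤ/m)ˣ → 𝔽_pˣ` and its Teichmüller lift `ψ₁` (level `m`) with `θ_S = b ∘ χ_m ∘ res`, `θ_Q = χ̄_p·(b ∘ χ_m ∘ res)⁻¹`, and at level
`f·m·p`: **`ψ↑ = ψ₁↑` or `ψ↑ = ψ₁⁻¹↑·ω↑`**. So `{θ_S, θ_Q}` are the reductions of `{ψ, ψ⁻¹ω}` composed with the cyclotomic character
and restricted to `Γ_K` — the anatomy's «`{θ, θ'} = {ψ̄|, ψ̄⁻¹ω̄|}`» (M1 memo head) as a kernel theorem, Chebotarev-free.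
[cite: KrizLi2019, §1.5 (p. 7) and §7.1 (p. 43, «interchange ψ and ψ⁻¹ω»)] [cite: Mazur1978, §5 (p. 148) and §6 Prop. 6.3 (1) (p. 153)]
[cite: Washington1997, Thm. 14.1 (Kronecker–Weber)] -/
theorem exists_dirichletCharacter_charSub_eq_or_eq_of_hss (hCM : W.HasCM) (h5 : 5 ≤ p) (hram : CMRamified W p)
    {f : ℕ} [NeZero f] (ψ : DirichletCharacter ℚ_[p] f) (ω : DirichletCharacter ℚ_[p] p)
    (hω : KrizLi2019.IsTeichmullerCharacter ω)
    (hss : ∀ ℓ : ℕ, ℓ.Prime → ¬ (ℓ ∣ p * W.conductorNorm ℤ) →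
      ‖((W.LFunction ℓ : ℤ) : ℚ_[p]) - (ψ (ℓ : ZMod f) + ψ⁻¹ (ℓ : ZMod f) * ω (ℓ : ZMod p))‖ < 1)
    (hK2 : Module.finrank ℚ K = 2)
    (Φ : X2.ResidualDevissageModules.StableSubgroup (absoluteGaloisGroup K) ((W.baseChange K).geomTorsion (p : ℤ)))
    (hcard : Nat.card Φ.Sub = p) {θS θQ : absoluteGaloisGroup K →* (ZMod p)ˣ}
    (hθS : ∀ (g : absoluteGaloisGroup K) (x : Φ.Sub), g • x = (((θS g : ZMod p).val : ℕ) : ℤ) • x)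
    (hθQ : ∀ (g : absoluteGaloisGroup K) (y : Φ.Quot), g • y = (((θQ g : ZMod p).val : ℕ) : ℤ) • y) :
    ∃ (m : ℕ) (_ : NeZero m) (b : (ZMod m)ˣ →* (ZMod p)ˣ) (ψ₁ : DirichletCharacter ℚ_[p] m)
      (hf : f ∣ f * m * p) (hm : m ∣ f * m * p) (hpM : p ∣ f * m * p),
      (∀ g : absoluteGaloisGroup K, θS g = b (modNCyclotomicCharacter ℚ m (absGaloisRestrict ℚ K g))) ∧
      (∀ g : absoluteGaloisGroup K, θQ g = modPCyclotomicCharacterZMod ℚ p (absGaloisRestrict ℚ K g) *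
        (b (modNCyclotomicCharacter ℚ m (absGaloisRestrict ℚ K g)))⁻¹) ∧
      (∀ u : (ZMod m)ˣ, ψ₁ (u : ZMod m) = (((Kato2004.teichmullerChar p (b u) : ℤ_[p]ˣ) : ℤ_[p]) : ℚ_[p])) ∧
      (DirichletCharacter.changeLevel hf ψ = DirichletCharacter.changeLevel hm ψ₁ ∨
        DirichletCharacter.changeLevel hf ψ =
          DirichletCharacter.changeLevel hm ψ₁⁻¹ * DirichletCharacter.changeLevel hpM ω) := by
  have hpr : p.Prime := hp.out
  have hp2 : p ≠ 2 := by omega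
  obtain ⟨m, hmz, b, hS, hQ, htr⟩ := exists_dirichletFactor_charSub_of_cmRamified W p K hCM h5 hram hK2 Φ hcard hθS hθQ
  obtain ⟨ψ₁, hψ₁⟩ := exists_teichmuller_dirichletCharacter p b
  haveI : NeZero (f * m * p) := ⟨Nat.mul_ne_zero (Nat.mul_ne_zero (NeZero.ne f) (NeZero.ne m)) hpr.ne_zero⟩
  have hf : f ∣ f * m * p := dvd_mul_of_dvd_left (dvd_mul_right f m) p
  have hm : m ∣ f * m * p := dvd_mul_of_dvd_left (dvd_mul_left m f) p
  have hpM : p ∣ f * m * p := dvd_mul_left p (f * m)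
  refine ⟨m, hmz, b, ψ₁, hf, hm, hpM, hS, hQ, hψ₁, ?_⟩
  -- both `(ψ₁, ω)` and `(ψ, ω)` are within `1` of `a_ℓ` at every prime `ℓ ∤ p m N_W`
  have hN : p * m * W.conductorNorm ℤ ≠ 0 :=
    Nat.mul_ne_zero (Nat.mul_ne_zero hpr.ne_zero (NeZero.ne m)) W.conductorNorm_pos_holds.ne'
  have h := EisensteinPair.eq_or_eq_of_traceForm_congr (p := p) hp2 hm hf hpM ψ₁ ψ ω hN (fun ℓ hℓ hℓN => by
    haveI : Fact ℓ.Prime := ⟨hℓ⟩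
    have hℓp : ℓ ≠ p := by rintro rfl; exact hℓN (dvd_mul_of_dvd_left (dvd_mul_right ℓ m) _)
    have hℓm : ℓ.Coprime m := (Nat.Prime.coprime_iff_not_dvd hℓ).mpr fun hd =>
      hℓN (dvd_mul_of_dvd_left (dvd_mul_of_dvd_right hd p) _)
    have hℓN' : ¬ ℓ ∣ p * W.conductorNorm ℤ := fun hd => by
      apply hℓN
      rcases (Nat.Prime.dvd_mul hℓ).mp hd with h1 | h1
      · exact dvd_mul_of_dvd_left (dvd_mul_of_dvd_left h1 m) _
      · exact dvd_mul_of_dvd_right h1 _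
    have hgood : W.HasGoodReductionAtPrime ℓ := by
      by_contra hbad
      exact hℓN' (dvd_mul_of_dvd_right ((W.dvd_conductorNorm_iff_not_hasGoodReductionAtPrime ℓ).mpr hbad) _)
    have ha : ((W.LFunction ℓ : ℤ) : ZMod p) = ((b (ZMod.unitOfCoprime ℓ hℓm) : (ZMod p)ˣ) : ZMod p) +
        (ℓ : ZMod p) * (((b (ZMod.unitOfCoprime ℓ hℓm))⁻¹ : (ZMod p)ˣ) : ZMod p) := by
      rw [LFunction_apply_prime_eq_frobeniusTrace W ℓ hgood]; exact htr ℓ hℓN hℓm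
    have h1 := norm_traceForm_sub_lt_one_of_congr p b hψ₁ hω hℓ hℓp hℓm ha
    have h2 := hss ℓ hℓ hℓN'
    -- ultrametric: `‖S₁ − S₂‖ ≤ max ‖a − S₂‖ ‖a − S₁‖`
    have e : (ψ₁ (ℓ : ZMod m) + ψ₁⁻¹ (ℓ : ZMod m) * ω (ℓ : ZMod p)) - (ψ (ℓ : ZMod f) + ψ⁻¹ (ℓ : ZMod f) * ω (ℓ : ZMod p)) =
        (((W.LFunction ℓ : ℤ) : ℚ_[p]) - (ψ (ℓ : ZMod f) + ψ⁻¹ (ℓ : ZMod f) * ω (ℓ : ZMod p))) +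
          -(((W.LFunction ℓ : ℤ) : ℚ_[p]) - (ψ₁ (ℓ : ZMod m) + ψ₁⁻¹ (ℓ : ZMod m) * ω (ℓ : ZMod p))) := by ring
    rw [e]
    refine lt_of_le_of_lt (IsUltrametricDist.norm_add_le_max _ _) (max_lt h2 ?_)
    rw [norm_neg]; exact h1)
  rcases h with h | h
  · exact Or.inl h
  · exact Or.inr h

end QpAvatar

end Summit.BirchSwinnertonDyer.BirchSwinnertonDyer.Theorems.PrintCFram.HerbrandLineCharacters

end
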